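import Summits.ResolutionOfSingularities.ResolutionOfSingularities.Theorems.PurelyInseparableDim4TschirnhausJetStep
import Literature.AlgebraicGeometry.Resolution.PointBlowupShadeCentres
import HarnessLib
import HarnessLib.Audit.Tags

/-!
# Purely inseparable four-folds — TSCHIRNHAUS EXISTENCE AT THE JET LEVEL for one contact letter,
# and uniqueness of the jet (cell `res-dim4-pi`, K2(p) lane, brick (ii) FILE D, part 2)

[OURS · counted 0 · cell `res-dim4-pi` · brick (ii) «Tschirnhaus / W-frame infrastructure», FILE D, desk
WORDS #81/#83 (statement of record = bus l.2646), seat res-dim4-p-1 g3.]  Nothing here proves K2(p),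
`NoIsolatedTrap p p` or resolution of singularities in dimension ≥ 4 / characteristic `p`.  AI kernel
work, weaker than expert review.

For `G ∈ K[x₁..x₄]`, a letter `f`, `1 ≤ d` a unit of `K`, `c := coeff_{x_f^d} G ≠ 0` and no
`x_f^{d-1}`-monomial — in the frame: `ord₀ G = d` and `in_d G = c·x_f^d`, the residual cone is the `d`-th
power of one free letter (idea-4's class with `e_G = 3` after the linear W-frame move of FILE B3) —
iterating part 1's `jet_step` from `φ₀ = 0` gives:

* §4 `exists_jet` (support form) / **`exists_tschirnhaus_jet`** (binders of FILE B: `φ(0) = 0`,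
  `f ∉ vars φ`, `2 ≤ ord₀ φ`): for every `N` a `φ_N ∈ K[x_{≠f}]` such that for EVERY `K`-algebra
  endomorphism `τ` with `τ x_f = x_f + φ_N`, `τ x_i = x_i` — in particular `FrameChange.tsch f φ_N` —
  all monomials `x_f^{d-1}·u^m`, `|m| ≤ N`, have coefficient `0` in `τ G`; the linear part of `φ_N` is
  `−(d c)⁻¹·`(the `u`-linear part of the `x_f^{d-1}`-coefficient of `G`), whence `ord₀ φ_N ≥ 2` exactly
  under `in_d G = c·x_f^d` (`exists_tschirnhaus_jet_of_initialForm`, over the tree's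
  `HauserPerlega2019.initialForm`).
* **`jet_unique`** / `tschirnhaus_jet_unique`: two admissible `φ, ψ` doing the job to order `N` agree in
  all degrees `≤ N` (the lowest difference `Δ_m` would reappear as `d·c·Δ_m`).
* §5 the dictionary between the support form `∀ a ∈ φ.support, a_f = 0 ∧ 1 ≤ |a|` and FILE B's binders
  (`forall_support_iff`), the `n_f = d − 1` indexing (`coeff_eq_zero_of_jet`), `two_le_ordZero_of_forall_coeff`.

In `K[[u]]` the full statement is Weierstrass preparation + `x_f ↦ x_f − a_{d−1}/d`; the cards (I-4-7
(TS)(i)(ii), E2-WINDOW (A3), slice C (C4)/(C5)) read a bounded jet per blow-up step, which is what is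
typed here.  What is NOT here: the linear W-frame move `ℓ ↦ x_f` (FILE B3), the two-letter /
boundary-letter variant of (A2) with a complement `W ⊂ Sym^{d-1}` (part 1's §§1–2 are the tools for
that solve as well), the state-level packaging with the boundary monomial `x^r` and the isolation /
`resVertex` / shade invariances (FILE C), anything about blow-ups.
Sources: [cite: Abhyankar1990, Lecture 22 p.174 and p.186]; [cite: CossartPiltant2009, I.8.3.6];
[cite: Kollar2007, 1.89 and Aside 3.57]; [cite: Hauser2014Obergurgl, Def. 9.3–Prop. 9.5].
bears_on: LADDER-RESOLUTION:D157-DOOR2 (res-dim4-pi · K2(p) · brick (ii) FILE D).  Supports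
stmt-ResolutionOfSingularities-16155 (helper).
-/

set_option linter.dupNamespace false -- mandated namespace of this single-conjunct summit

noncomputable section

namespace Summit.ResolutionOfSingularities.ResolutionOfSingularities.Theorems.PIDim4

namespace FrameChange

open MvPolynomial Finset
open Literature.AlgebraicGeometry.Resolution.Hauser2010
open Literature.AlgebraicGeometry.Resolution.HauserPerlega2019

variable {K : Type} [Field K]

/-! ## 4. Existence and uniqueness of the Tschirnhaus jet -/

/-- **Jet-level Tschirnhaus existence (support form).**  `c = coeff_{x_f^d} G ≠ 0`, `d ≠ 0` in `K`,
no `x_f^{d-1}`-term: for every `N` there is an `x_f`-free `φ` with `φ(0) = 0` such that all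
`x_f^{d-1}·u^m`-coefficients (`|m| ≤ N`) of `G(x_f + φ, u)` vanish; its linear part is
`−(d c)⁻¹·`(the `u`-linear part of the `x_f^{d-1}`-coefficient of `G`).
[cite: Abhyankar1990, Lecture 22 p.174 and p.186] [cite: CossartPiltant2009, I.8.3.6] [folklore] -/
theorem exists_jet (f : Fin 4) {d : ℕ} (hd : 1 ≤ d) (hdK : (d : K) ≠ 0) (G : MvPolynomial (Fin 4) K)
    (hc : coeff (Finsupp.single f d) G ≠ 0) (h0 : coeff (Finsupp.single f (d - 1)) G = 0) (N : ℕ) :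
    ∃ φ : MvPolynomial (Fin 4) K,
      (∀ a ∈ φ.support, a f = 0 ∧ 1 ≤ a.degree) ∧
      (∀ m : Fin 4 →₀ ℕ, m f = 0 → m.degree = 1 →
        coeff m φ = -coeff (m + Finsupp.single f (d - 1)) G / (d * coeff (Finsupp.single f d) G)) ∧
      ∀ τ : MvPolynomial (Fin 4) K →ₐ[K] MvPolynomial (Fin 4) K, τ (X f) = X f + φ →
        (∀ i, i ≠ f → τ (X i) = X i) →
        ∀ m : Fin 4 →₀ ℕ, m f = 0 → m.degree ≤ N →
          coeff (m + Finsupp.single f (d - 1)) (τ G) = 0 := by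
  suffices h : ∀ N, 1 ≤ N → ∃ φ : MvPolynomial (Fin 4) K,
      (∀ a ∈ φ.support, a f = 0 ∧ 1 ≤ a.degree) ∧
      (∀ m : Fin 4 →₀ ℕ, m f = 0 → m.degree = 1 →
        coeff m φ = -coeff (m + Finsupp.single f (d - 1)) G / (d * coeff (Finsupp.single f d) G)) ∧
      ∀ τ : MvPolynomial (Fin 4) K →ₐ[K] MvPolynomial (Fin 4) K, τ (X f) = X f + φ →
        (∀ i, i ≠ f → τ (X i) = X i) →
        ∀ m : Fin 4 →₀ ℕ, m f = 0 → m.degree ≤ N →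
          coeff (m + Finsupp.single f (d - 1)) (τ G) = 0 by
    rcases Nat.eq_zero_or_pos N with hN | hN
    · obtain ⟨φ, h1, h2, h3⟩ := h 1 le_rfl
      exact ⟨φ, h1, h2, fun τ hτf hτ m hmf hm => h3 τ hτf hτ m hmf (by omega)⟩
    · exact h N hN
  intro N hN
  induction N, hN using Nat.le_induction with
  | base =>
    have hstep := jet_step hd hdK hc (φ := 0) (by simp) (AlgHom.id K _) (by simp) (fun i _ => rfl)
      (N := 0) (fun m hmf hm => by
        have hm0 : m = 0 := (Finsupp.degree_eq_zero_iff m).mp (Nat.le_zero.mp hm)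
        rw [hm0, zero_add, AlgHom.id_apply]
        exact h0)
    obtain ⟨δ, hδs, hδc, hδj⟩ := hstep
    refine ⟨δ, fun a ha => ⟨(hδs a ha).1, by rw [(hδs a ha).2]⟩, fun m hmf hm => ?_,
      fun τ hτf hτ => hδj τ (by rw [zero_add]; exact hτf) hτ⟩
    rw [hδc m hmf (by rw [hm]), AlgHom.id_apply]
  | succ N hN ih =>
    obtain ⟨φ, hφs, hφl, hφj⟩ := ih
    let τφ : MvPolynomial (Fin 4) K →ₐ[K] MvPolynomial (Fin 4) K :=
      aeval fun i => if i = f then X f + φ else X i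
    have hτφf : τφ (X f) = X f + φ := by simp [τφ]
    have hτφi : ∀ i, i ≠ f → τφ (X i) = X i := fun i hi => by simp [τφ, hi]
    obtain ⟨δ, hδs, -, hδj⟩ := jet_step hd hdK hc hφs τφ hτφf hτφi (hφj τφ hτφf hτφi)
    refine ⟨φ + δ, fun a ha => ?_, fun m hmf hm => ?_, hδj⟩
    · rcases Finset.mem_union.mp (support_add ha) with h | h
      · exact hφs a h
      · exact ⟨(hδs a h).1, by rw [(hδs a h).2]; omega⟩
    · have hδm : coeff m δ = 0 := by
        by_contra hne
        have h := (hδs m (mem_support_iff.mpr hne)).2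
        omega
      rw [coeff_add, hφl m hmf hm, hδm, add_zero]

/-- **Uniqueness of the Tschirnhaus jet**: two `x_f`-free `φ, ψ` with `φ(0) = ψ(0) = 0` that both kill the
`x_f^{d-1}·u^m`-coefficients of `G(x_f + ·, u)` for `|m| ≤ N` agree up to degree `N`
(the lowest-degree difference `Δ_m` would reappear as `d·c·Δ_m` in that coefficient).
[cite: Abhyankar1990, Lecture 22 p.174] [folklore] -/
theorem jet_unique (f : Fin 4) {d : ℕ} (hd : 1 ≤ d) (hdK : (d : K) ≠ 0) (G : MvPolynomial (Fin 4) K)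
    (hc : coeff (Finsupp.single f d) G ≠ 0) {N : ℕ} {φ ψ : MvPolynomial (Fin 4) K}
    (hφ : ∀ a ∈ φ.support, a f = 0 ∧ 1 ≤ a.degree) (hψ : ∀ a ∈ ψ.support, a f = 0 ∧ 1 ≤ a.degree)
    (τφ τψ : MvPolynomial (Fin 4) K →ₐ[K] MvPolynomial (Fin 4) K)
    (hτφf : τφ (X f) = X f + φ) (hτφ : ∀ i, i ≠ f → τφ (X i) = X i)
    (hτψf : τψ (X f) = X f + ψ) (hτψ : ∀ i, i ≠ f → τψ (X i) = X i)
    (hNφ : ∀ m : Fin 4 →₀ ℕ, m f = 0 → m.degree ≤ N →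
      coeff (m + Finsupp.single f (d - 1)) (τφ G) = 0)
    (hNψ : ∀ m : Fin 4 →₀ ℕ, m f = 0 → m.degree ≤ N →
      coeff (m + Finsupp.single f (d - 1)) (τψ G) = 0) :
    ∀ m : Fin 4 →₀ ℕ, m.degree ≤ N → coeff m φ = coeff m ψ := by
  classical
  suffices h : ∀ n, n ≤ N → ∀ m : Fin 4 →₀ ℕ, m.degree = n → coeff m φ = coeff m ψ from
    fun m hm => h m.degree hm m rfl
  intro n
  refine Nat.strong_induction_on n ?_
  intro n ih hn m hmn
  by_cases hmf : m f = 0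
  swap
  · rw [notMem_support_iff.mp (fun h => hmf (hφ m h).1),
      notMem_support_iff.mp (fun h => hmf (hψ m h).1)]
  rcases Nat.eq_zero_or_pos n with hn0 | hn0
  · have hm0 : m = 0 := (Finsupp.degree_eq_zero_iff m).mp (hmn.trans hn0)
    subst hm0
    rw [notMem_support_iff.mp (fun h => ?_), notMem_support_iff.mp (fun h => ?_)]
    · have := (hψ 0 h).2
      rw [map_zero] at this
      exact Nat.not_succ_le_zero 0 this
    · have := (hφ 0 h).2
      rw [map_zero] at this
      exact Nat.not_succ_le_zero 0 this
  by_contra hne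
  -- the difference `Δ = ψ − φ` has all its monomials `x_f`-free of degree `≥ n`
  obtain ⟨Δ, hΔ⟩ : ∃ Δ : MvPolynomial (Fin 4) K, Δ = ψ - φ := ⟨_, rfl⟩
  have hΔsupp : ∀ a ∈ Δ.support, a f = 0 ∧ n ≤ a.degree := by
    intro a ha
    have ha' : coeff a φ ≠ coeff a ψ := by
      intro h
      rw [hΔ, mem_support_iff, coeff_sub, h, sub_self] at ha
      exact ha rfl
    refine ⟨?_, ?_⟩
    · by_contra haf
      exact ha' (by rw [notMem_support_iff.mp (fun h => haf (hφ a h).1),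
        notMem_support_iff.mp (fun h => haf (hψ a h).1)])
    · by_contra hlt
      push Not at hlt
      exact ha' (ih a.degree hlt (by omega) a rfl)
  -- `τψ = τ_Δ ∘ τφ`
  let τΔ : MvPolynomial (Fin 4) K →ₐ[K] MvPolynomial (Fin 4) K :=
    aeval fun i => if i = f then X f + Δ else X i
  have hτΔf : τΔ (X f) = X f + Δ := by simp [τΔ]
  have hτΔi : ∀ i, i ≠ f → τΔ (X i) = X i := fun i hi => by simp [τΔ, hi]
  have hτΔφ : τΔ φ = φ := by
    have h := MvPolynomial.hom_congr_vars
      (f₁ := (τΔ : MvPolynomial (Fin 4) K →+* MvPolynomial (Fin 4) K))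
      (f₂ := RingHom.id _) (p₁ := φ) (p₂ := φ) (by ext a; simp [τΔ]) (fun i hi _ => by
        have hif : i ≠ f := by
          intro hif
          obtain ⟨a, ha, hia⟩ := (MvPolynomial.mem_vars_iff_mem_support i).mp hi
          exact (Finsupp.mem_support_iff.mp hia) (by rw [hif]; exact (hφ a ha).1)
        rw [RingHom.coe_coe, hτΔi i hif, RingHom.id_apply]) rfl
    simpa using h
  have hcomp : τψ = τΔ.comp τφ := by
    refine MvPolynomial.algHom_ext fun i => ?_
    by_cases hi : i = f
    · rw [hi, hτψf, AlgHom.comp_apply, hτφf, map_add, hτΔf, hτΔφ, hΔ]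
      ring
    · rw [hτψ i hi, AlgHom.comp_apply, hτφ i hi, hτΔi i hi]
  obtain ⟨R, hR⟩ := exists_taylor_two τΔ f Δ hτΔf hτΔi (τφ G)
  have h3 : coeff (Finsupp.single f (d - 1)) (Δ * R) = 0 := by
    rw [← zero_add (Finsupp.single f (d - 1))]
    exact coeff_add_single_mul_eq_zero hΔsupp R (by rw [map_zero]; exact hn0) _
  have key := hNψ m hmf (hmn.le.trans hn)
  rw [hcomp, AlgHom.comp_apply, hR, coeff_add, coeff_add, hNφ m hmf (hmn.le.trans hn), zero_add,
    coeff_add_single_mul_of_degree_le hΔsupp _ hmn.le, coeff_pderiv, ← Finsupp.single_add,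
    Nat.sub_add_cancel hd, coeff_single_frameChange τφ f φ hτφf hτφ hφ G d, Finsupp.single_eq_same,
    cast_pred_add_one hd, pow_two, mul_assoc, coeff_add_single_mul_of_degree_le hΔsupp _ hmn.le,
    h3, mul_zero, add_zero] at key
  have hΔm : coeff m Δ = 0 := by
    rcases mul_eq_zero.mp key with h | h
    · exact h
    · exact absurd h (mul_ne_zero hc hdK)
  rw [hΔ, coeff_sub, sub_eq_zero] at hΔm
  exact hne hΔm.symm

/-! ## 5. Re-packaging: `φ(0) = 0 ∧ x_f ∉ vars φ`, the `x_f^{d-1}·u^m` monomials, `ord₀ φ ≥ 2` -/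

/-- The support condition «`x_f`-free with no constant term» is `φ(0) = 0 ∧ f ∉ φ.vars`. [folklore] -/
theorem forall_support_iff (f : Fin 4) (φ : MvPolynomial (Fin 4) K) :
    (∀ a ∈ φ.support, a f = 0 ∧ 1 ≤ a.degree) ↔ constantCoeff φ = 0 ∧ f ∉ φ.vars := by
  constructor
  · intro h
    refine ⟨?_, ?_⟩
    · exact notMem_support_iff.mp fun hs => by
        have := (h 0 hs).2
        rw [map_zero] at this
        exact Nat.not_succ_le_zero 0 this
    · rw [MvPolynomial.mem_vars_iff_mem_support]
      rintro ⟨a, ha, hfa⟩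
      exact (Finsupp.mem_support_iff.mp hfa) (h a ha).1
  · rintro ⟨h0, hf⟩ a ha
    refine ⟨?_, ?_⟩
    · by_contra haf
      exact hf ((MvPolynomial.mem_vars_iff_mem_support f).mpr ⟨a, ha, Finsupp.mem_support_iff.mpr haf⟩)
    · by_contra hlt
      have ha0 : a = 0 := (Finsupp.degree_eq_zero_iff a).mp (by omega)
      rw [ha0, mem_support_iff] at ha
      exact ha h0

/-- From the `m + (d-1)·e_f` indexing to the monomials `n` with `n_f = d − 1`, `|n| ≤ N + (d − 1)`.
[folklore] -/
theorem coeff_eq_zero_of_jet {f : Fin 4} {d N : ℕ} {P : MvPolynomial (Fin 4) K}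
    (h : ∀ m : Fin 4 →₀ ℕ, m f = 0 → m.degree ≤ N → coeff (m + Finsupp.single f (d - 1)) P = 0)
    {n : Fin 4 →₀ ℕ} (hnf : n f = d - 1) (hn : n.degree ≤ N + (d - 1)) : coeff n P = 0 := by
  have hsplit : n = n.erase f + Finsupp.single f (d - 1) := by
    rw [← hnf, Finsupp.erase_add_single]
  have hdeg := congrArg Finsupp.degree hsplit
  rw [map_add, Finsupp.degree_single] at hdeg
  rw [hsplit]
  exact h _ (Finsupp.erase_same) (by omega)

/-- An `x_f`-free `φ` with `φ(0) = 0` and no linear part has `ord₀ φ ≥ 2`. [folklore] -/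
theorem two_le_ordZero_of_forall_coeff {f : Fin 4} {φ : MvPolynomial (Fin 4) K}
    (hφ : ∀ a ∈ φ.support, a f = 0 ∧ 1 ≤ a.degree)
    (hlin : ∀ m : Fin 4 →₀ ℕ, m f = 0 → m.degree = 1 → coeff m φ = 0) :
    (2 : ℕ∞) ≤ ordZero φ := by
  rw [show (2 : ℕ∞) = ((2 : ℕ) : ℕ∞) from rfl, natCast_le_ordZero_iff_forall_coeff]
  intro a ha
  by_cases haf : a f = 0
  · rcases Nat.lt_or_ge a.degree 1 with h1 | h1
    · exact notMem_support_iff.mp fun hs => by have := (hφ a hs).2; omega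
    · exact hlin a haf (by omega)
  · exact notMem_support_iff.mp fun hs => haf (hφ a hs).1

/-- **Jet-level Tschirnhaus existence** (statement of record, desk WORD #83 (a)).  Let `f` be a letter,
`1 ≤ d` with `d ≠ 0` in `K`, and `G ∈ K[x₁..x₄]` with `coeff_{x_f^d} G ≠ 0` and no monomial
`x_f^{d-1}` or `x_f^{d-1}·x_i` (both implied by `in_d G = c·x_f^d`).  Then for every `N` there is
`φ ∈ K[x_{≠f}]` with `φ(0) = 0`, `f ∉ vars φ`, `ord₀ φ ≥ 2`, such that for EVERY `K`-algebra endomorphism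
`τ` with `τ x_f = x_f + φ`, `τ x_i = x_i` (`i ≠ f`) — in particular FILE B's `FrameChange.tsch f φ` — every
monomial `n` with `n_f = d − 1` and `|n| ≤ N + (d − 1)` has coefficient `0` in `τ G`.
[cite: Abhyankar1990, Lecture 22 p.174 (SDT `X_n → X_n + f̂₁/d`, `d` prime to the characteristic) and
p.186 (jet level)] [cite: CossartPiltant2009, I.8.3.6] [cite: Kollar2007, Aside 3.57] [folklore] -/
theorem exists_tschirnhaus_jet (f : Fin 4) {d : ℕ} (hd : 1 ≤ d) (hdK : (d : K) ≠ 0)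
    (G : MvPolynomial (Fin 4) K) (hc : coeff (Finsupp.single f d) G ≠ 0)
    (hG : ∀ m : Fin 4 →₀ ℕ, m f = 0 → m.degree ≤ 1 → coeff (m + Finsupp.single f (d - 1)) G = 0)
    (N : ℕ) :
    ∃ φ : MvPolynomial (Fin 4) K, constantCoeff φ = 0 ∧ f ∉ φ.vars ∧ (2 : ℕ∞) ≤ ordZero φ ∧
      ∀ τ : MvPolynomial (Fin 4) K →ₐ[K] MvPolynomial (Fin 4) K, τ (X f) = X f + φ →
        (∀ i, i ≠ f → τ (X i) = X i) →
        ∀ n : Fin 4 →₀ ℕ, n f = d - 1 → n.degree ≤ N + (d - 1) → coeff n (τ G) = 0 := by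
  have h0 : coeff (Finsupp.single f (d - 1)) G = 0 := by
    have := hG 0 (by simp) (by simp)
    rwa [zero_add] at this
  obtain ⟨φ, hφs, hφl, hφj⟩ := exists_jet f hd hdK G hc h0 N
  refine ⟨φ, ((forall_support_iff f φ).mp hφs).1, ((forall_support_iff f φ).mp hφs).2,
    two_le_ordZero_of_forall_coeff hφs fun m hmf hm => ?_,
    fun τ hτf hτ n hnf hn => coeff_eq_zero_of_jet (hφj τ hτf hτ) hnf hn⟩
  rw [hφl m hmf hm, hG m hmf hm.le, neg_zero, zero_div]

/-- **Uniqueness of the Tschirnhaus jet** in the same binders: two admissible `φ, ψ` doing the job to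
order `N` have the same coefficients in all degrees `≤ N`. [cite: Abhyankar1990, Lecture 22 p.174]
[folklore] -/
theorem tschirnhaus_jet_unique (f : Fin 4) {d : ℕ} (hd : 1 ≤ d) (hdK : (d : K) ≠ 0)
    (G : MvPolynomial (Fin 4) K) (hc : coeff (Finsupp.single f d) G ≠ 0) {N : ℕ}
    {φ ψ : MvPolynomial (Fin 4) K} (h0φ : constantCoeff φ = 0) (hφ : f ∉ φ.vars)
    (h0ψ : constantCoeff ψ = 0) (hψ : f ∉ ψ.vars)
    (τφ τψ : MvPolynomial (Fin 4) K →ₐ[K] MvPolynomial (Fin 4) K)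
    (hτφf : τφ (X f) = X f + φ) (hτφ : ∀ i, i ≠ f → τφ (X i) = X i)
    (hτψf : τψ (X f) = X f + ψ) (hτψ : ∀ i, i ≠ f → τψ (X i) = X i)
    (hNφ : ∀ n : Fin 4 →₀ ℕ, n f = d - 1 → n.degree ≤ N + (d - 1) → coeff n (τφ G) = 0)
    (hNψ : ∀ n : Fin 4 →₀ ℕ, n f = d - 1 → n.degree ≤ N + (d - 1) → coeff n (τψ G) = 0) :
    ∀ m : Fin 4 →₀ ℕ, m.degree ≤ N → coeff m φ = coeff m ψ := by
  have hmf : ∀ m : Fin 4 →₀ ℕ, m f = 0 → m.degree ≤ N →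
      (m + Finsupp.single f (d - 1)) f = d - 1 ∧ (m + Finsupp.single f (d - 1)).degree ≤ N + (d - 1) :=
    fun m hmf hm => ⟨by rw [Finsupp.add_apply, hmf, Finsupp.single_eq_same, zero_add],
      by rw [map_add, Finsupp.degree_single]; omega⟩
  exact jet_unique f hd hdK G hc ((forall_support_iff f φ).mpr ⟨h0φ, hφ⟩)
    ((forall_support_iff f ψ).mpr ⟨h0ψ, hψ⟩) τφ τψ hτφf hτφ hτψf hτψ
    (fun m hm hN => hNφ _ (hmf m hm hN).1 (hmf m hm hN).2)
    (fun m hm hN => hNψ _ (hmf m hm hN).1 (hmf m hm hN).2)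

/-- **The frame's hypothesis form**: if `ord₀ G = d` and `in_d G = c·x_f^d` (`c ≠ 0`) — the residual
cone is the `d`-th power of the free letter `x_f` (the `e_G = 3` power cone after the linear W-frame
move) — then `G` has the two coefficient properties the solve reads, so `exists_tschirnhaus_jet`
applies. [cite: CossartPiltant2009, I.8.3.6] [folklore] -/
theorem exists_tschirnhaus_jet_of_initialForm (f : Fin 4) {d : ℕ} (hd : 1 ≤ d) (hdK : (d : K) ≠ 0)
    (G : MvPolynomial (Fin 4) K) {c : K} (hc : c ≠ 0) (hord : ordZero G = d)
    (hin : initialForm G = C c * X f ^ d) (N : ℕ) :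
    ∃ φ : MvPolynomial (Fin 4) K, constantCoeff φ = 0 ∧ f ∉ φ.vars ∧ (2 : ℕ∞) ≤ ordZero φ ∧
      ∀ τ : MvPolynomial (Fin 4) K →ₐ[K] MvPolynomial (Fin 4) K, τ (X f) = X f + φ →
        (∀ i, i ≠ f → τ (X i) = X i) →
        ∀ n : Fin 4 →₀ ℕ, n f = d - 1 → n.degree ≤ N + (d - 1) → coeff n (τ G) = 0 := by
  classical
  -- the degree-`d` coefficients of `G` are those of `c·x_f^d`
  have hcoeff : ∀ m : Fin 4 →₀ ℕ, m.degree = d →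
      coeff m G = if Finsupp.single f d = m then c else 0 := by
    intro m hm
    have h := congrArg (coeff m) hin
    rw [initialForm, hord, ENat.toNat_coe, coeff_homogeneousComponent, if_pos hm] at h
    rw [h, X_pow_eq_monomial, C_mul_monomial, mul_one, coeff_monomial]
  refine exists_tschirnhaus_jet f hd hdK G ?_ (fun m hmf hm => ?_) N
  · rw [hcoeff _ (Finsupp.degree_single f d), if_pos rfl]
    exact hc
  · rcases Nat.lt_or_ge m.degree 1 with h1 | h1
    · -- `m = 0`: the monomial `x_f^{d-1}` has degree `< ord₀ G`
      have hm0 : m = 0 := (Finsupp.degree_eq_zero_iff m).mp (by omega)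
      rw [hm0, zero_add]
      refine coeff_eq_zero_of_degree_lt_ordZero ?_
      rw [hord, Finsupp.degree_single]
      exact_mod_cast Nat.sub_lt hd Nat.one_pos
    · -- `|m| = 1`: a degree-`d` monomial other than `x_f^d`
      have hdeg : (m + Finsupp.single f (d - 1)).degree = d := by
        rw [map_add, Finsupp.degree_single]; omega
      rw [hcoeff _ hdeg, if_neg]
      intro h
      have := DFunLike.congr_fun h f
      rw [Finsupp.single_eq_same, Finsupp.add_apply, hmf, Finsupp.single_eq_same, zero_add] at this
      omega

end FrameChange

end Summit.ResolutionOfSingularities.ResolutionOfSingularities.Theorems.PIDim4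

end
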